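import Literature.AlgebraicGeometry.Motives.ProjClosedFractions
import Literature.AlgebraicGeometry.Resolution.ExtAnnihilatorAffineGlobal
import Mathlib.RingTheory.GradedAlgebra.Radical
import Mathlib.RingTheory.Ideal.Height
import Mathlib.RingTheory.KrullDimension.NonZeroDivisors
import Mathlib.Order.KrullDimension
import HarnessLib

/-!
# Dehomogenisation of homogeneous ideals on a standard chart of `ℙⁿ_k`: primes, heights, dimensions

Topic: `Literature/AlgebraicGeometry/Resolution` (the graded-to-chart dictionary of the global step of
Kawasaki's Macaulayfication, Kawasaki 2000, §5 / La. 5.3, where the forms `z_i` are chosen in the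
homogeneous coordinate ring while the annihilator ideals, heights and dimensions are computed on the
affine charts `D₊(x_j) = Spec (k[x]_{(x_j)})₀`; Hartshorne I §2: the maps `α` (dehomogenise,
`x_j := 1`) and `β` (homogenise) between `k[y₁, …, yₙ]` and the forms of `k[x₀, …, xₙ]`, proof of
Prop. 2.2 and Ex. 2.10: «`α` and `β` … set up a bijection … prime ideals correspond»).

For the chart ring `B_j = (k[x]_{(x_j)})₀` (`HomogeneousLocalization.Away`), the dehomogenisation
`ρ_j = ProjFrac.dehomAway k n j : k[x₀, …, xₙ] →+* B_j` (`x_i ↦ x_i/x_j`) of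
`Motives/ProjClosedFractions.lean`, and the HOMOGENISATION of an ideal `𝔮 ≤ B_j`, spelled with
Mathlib's homogeneous core as `((𝔮.comap ρ_j).homogeneousCore 𝒜).toIdeal` (the ideal generated by
the forms `G` with `ρ_j(G) ∈ 𝔮`; no new definition):

* `mem_homogeneousCore_comap_dehomAway_iff`, `map_dehomAway_homogeneousCore_comap`,
  `homogeneousCore_comap_dehomAway_le_iff`, `X_not_mem_homogeneousCore_comap_dehomAway`,
  `isPrime_homogeneousCore_comap_dehomAway` — a form `G` lies in the homogenisation iff
  `ρ_j(G) ∈ 𝔮`; dehomogenising the homogenisation gives `𝔮` back (every element of `B_j` is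
  `ρ_j` of a form); hence homogenisation is an ORDER EMBEDDING of the ideals of `B_j` into the
  homogeneous ideals of `k[x]` missing `x_j`, primes to primes;
* `isPrime_map_dehomAway`, `mem_of_dehomAway_mem_map`, `homogeneousCore_comap_map_dehomAway` — for
  a homogeneous prime `𝔭 ∌ x_j`, the dehomogenisation `ρ_j(𝔭) B_j` is prime, a form lies in `𝔭` iff
  its dehomogenisation lies in `ρ_j(𝔭) B_j`, and homogenising gives `𝔭` back;
* **heights** `height_map_dehomAway_le` (`ht ρ_j(𝔭)B_j ≤ ht 𝔭`: chains below transport) and its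
  numeric form `height_map_dehomAway_le_of_ringKrullDim_quotient`: `dim k[x]/𝔭 = e ⇒
  ht ρ_j(𝔭)B_j ≤ n + 1 - e` (`k[x]` is a catenary affine domain of dimension `n + 1`,
  `ExtAnnihilatorAffineGlobal.height_add_eq_of_ringKrullDim_quotient`) — the input `h𝔮` of the
  chart form of Kawasaki's key lemma (the chart annihilator avoids primes of small height);
* **dimensions** `ringKrullDim_quotient_add_one_le_of_map_dehomAway_le`:
  `dim B_j/𝔠 + 1 ≤ dim k[x]/J` for `J` homogeneous and any `𝔠 ⊇ ρ_j(J) B_j` (chains above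
  transport and are capped by the vertex ideal `(x₀, …, xₙ) ∋ x_j`), with the numeric form
  `ringKrullDim_quotient_le_of_map_dehomAway_le` (`dim k[x]/J ≤ l + 1 ⇒ dim B_j/𝔠 ≤ l`) — the
  chart-dimension bound of the pointwise verification (`KawasakiPointwise.lean`, binder `hdimJ`);
* `exists_X_not_mem_of_ringKrullDim_quotient_ne_zero` — a prime with positive-dimensional
  quotient misses some variable (it is not the vertex).

Only UPPER bounds are proved (no transcendence degree, no Laurent structure of `k[x]_{x_j}` is
used); they are what the Macaulayfication needs. Everything is proved; no named facts; no
definitions.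

## References

* R. Hartshorne, *Algebraic Geometry*, GTM 52 (1977): I §2, proof of Prop. 2.2, Ex. 2.6, Ex. 2.10;
  II Prop. 2.5 (b). [Hartshorne1977]
* T. Kawasaki, *On Macaulayfication of Noetherian schemes*, Trans. AMS 352 (2000), §5 (La. 5.3 and
  the proof of Thm. 5.1, p. 2539). [Kawasaki2000]
-/

noncomputable section

open MvPolynomial HomogeneousLocalization
open Literature.AlgebraicGeometry.Morphisms.ProjCech
open Literature.AlgebraicGeometry.Motives Literature.AlgebraicGeometry.Motives.ProjFrac

universe u

attribute [local instance] MvPolynomial.gradedAlgebra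

namespace Literature.AlgebraicGeometry.Resolution

variable {k : Type u} [Field k] {n : ℕ} (j : Fin (n + 1))

/-! ## The dehomogenisation map `ρ_j : k[x₀,…,xₙ] → (k[x]_{(x_j)})₀` on forms -/

/-- `ρ_j(x_j) = 1`. [folklore] -/
private theorem dehomAway_X_eq_one :
    dehomAway k n j (X j : MvPolynomial (Fin (n + 1)) k) = 1 := by
  rw [dehomAway_of_mem j (ProjectiveSpace.X_mem (R := k) j)]
  apply val_injective
  rw [Away.val_mk, val_one, Localization.mk_eq_mk', IsLocalization.mk'_eq_iff_eq_mul, one_mul]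
  simp

/-- Every element of the chart ring `(k[x]_{(x_j)})₀` is the dehomogenisation `ρ_j(G) = G/x_j^m`
of a form `G` of some degree `m`. [cite: Hartshorne1977, I §2, proof of Prop. 2.2] -/
theorem exists_eq_dehomAway (b : Away (grading k n) (X j : MvPolynomial (Fin (n + 1)) k)) :
    ∃ (m : ℕ) (G : MvPolynomial (Fin (n + 1)) k), G ∈ grading k n m ∧ dehomAway k n j G = b := by
  obtain ⟨m, G, hG, rfl⟩ := Away.mk_surjective (grading k n) (ProjectiveSpace.X_mem (R := k) j) b
  have hG' : G ∈ grading k n m := by simpa using hG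
  exact ⟨m, G, hG', dehomAway_of_mem j hG'⟩

/-- The value of `ρ_j(G)` in `k[x]_{x_j}` for a form `G` of degree `m` is the fraction `G / x_j^m`.
[folklore] -/
private theorem val_dehomAway_of_mem {m : ℕ} {G : MvPolynomial (Fin (n + 1)) k}
    (hG : G ∈ grading k n m) :
    (dehomAway k n j G).val =
      IsLocalization.mk' (Localization.Away (X j : MvPolynomial (Fin (n + 1)) k)) G
        (⟨X j ^ m, m, rfl⟩ : Submonoid.powers (X j : MvPolynomial (Fin (n + 1)) k)) := by
  rw [dehomAway_of_mem j hG, Away.val_mk, Localization.mk_eq_mk']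

/-! ## Homogenisation of ideals of the chart ring -/

/-- **Forms in the homogenisation**: for an ideal `𝔮` of the chart ring and a FORM `G`, `G` lies in
the homogenisation `(ρ_j⁻¹ 𝔮)^{hom}` (the homogeneous core of the preimage) iff `ρ_j(G) ∈ 𝔮`.
[cite: Hartshorne1977, I §2, proof of Prop. 2.2 and Ex. 2.10] -/
theorem mem_homogeneousCore_comap_dehomAway_iff
    (𝔮 : Ideal (Away (grading k n) (X j : MvPolynomial (Fin (n + 1)) k))) {m : ℕ}
    {G : MvPolynomial (Fin (n + 1)) k} (hG : G ∈ grading k n m) :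
    G ∈ ((𝔮.comap (dehomAway k n j)).homogeneousCore (grading k n)).toIdeal ↔
      dehomAway k n j G ∈ 𝔮 :=
  ⟨fun h => Ideal.toIdeal_homogeneousCore_le (grading k n) (𝔮.comap (dehomAway k n j)) h,
    fun h => Ideal.mem_homogeneousCore_of_homogeneous_of_mem ⟨m, hG⟩ h⟩

/-- **Dehomogenising the homogenisation gives the ideal back**: `ρ_j((ρ_j⁻¹ 𝔮)^{hom}) · B_j = 𝔮`
(every element of the chart ring is `ρ_j` of a form). [cite: Hartshorne1977, I §2, proof of Prop. 2.2] -/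
theorem map_dehomAway_homogeneousCore_comap
    (𝔮 : Ideal (Away (grading k n) (X j : MvPolynomial (Fin (n + 1)) k))) :
    ((𝔮.comap (dehomAway k n j)).homogeneousCore (grading k n)).toIdeal.map (dehomAway k n j) = 𝔮 := by
  refine le_antisymm ((Ideal.map_mono (Ideal.toIdeal_homogeneousCore_le _ _)).trans
    Ideal.map_comap_le) fun b hb => ?_
  obtain ⟨m, G, hG, rfl⟩ := exists_eq_dehomAway j b
  exact Ideal.mem_map_of_mem _ ((mem_homogeneousCore_comap_dehomAway_iff j 𝔮 hG).mpr hb)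

/-- Homogenisation of chart ideals is monotone. [folklore] -/
private theorem homogeneousCore_comap_dehomAway_mono
    {𝔮 𝔮' : Ideal (Away (grading k n) (X j : MvPolynomial (Fin (n + 1)) k))} (h : 𝔮 ≤ 𝔮') :
    ((𝔮.comap (dehomAway k n j)).homogeneousCore (grading k n)).toIdeal ≤
      ((𝔮'.comap (dehomAway k n j)).homogeneousCore (grading k n)).toIdeal :=
  Ideal.homogeneousCore_mono (grading k n) (Ideal.comap_mono h)

/-- **Homogenisation reflects inclusions**: `(ρ_j⁻¹ 𝔮)^{hom} ≤ (ρ_j⁻¹ 𝔮')^{hom}` iff `𝔮 ≤ 𝔮'`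
(dehomogenise back). [cite: Hartshorne1977, I §2, proof of Prop. 2.2] -/
theorem homogeneousCore_comap_dehomAway_le_iff
    (𝔮 𝔮' : Ideal (Away (grading k n) (X j : MvPolynomial (Fin (n + 1)) k))) :
    ((𝔮.comap (dehomAway k n j)).homogeneousCore (grading k n)).toIdeal ≤
      ((𝔮'.comap (dehomAway k n j)).homogeneousCore (grading k n)).toIdeal ↔ 𝔮 ≤ 𝔮' := by
  refine ⟨fun h => ?_, homogeneousCore_comap_dehomAway_mono j⟩
  rw [← map_dehomAway_homogeneousCore_comap j 𝔮, ← map_dehomAway_homogeneousCore_comap j 𝔮']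
  exact Ideal.map_mono h

/-- `x_j` does not lie in the homogenisation of a proper chart ideal (`ρ_j(x_j) = 1`).
[cite: Hartshorne1977, I §2, proof of Prop. 2.2] -/
theorem X_not_mem_homogeneousCore_comap_dehomAway
    {𝔮 : Ideal (Away (grading k n) (X j : MvPolynomial (Fin (n + 1)) k))} (h𝔮 : 𝔮 ≠ ⊤) :
    (X j : MvPolynomial (Fin (n + 1)) k) ∉
      ((𝔮.comap (dehomAway k n j)).homogeneousCore (grading k n)).toIdeal := by
  intro h
  rw [mem_homogeneousCore_comap_dehomAway_iff j 𝔮 (ProjectiveSpace.X_mem (R := k) j),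
    dehomAway_X_eq_one] at h
  exact h𝔮 ((Ideal.eq_top_iff_one _).mpr h)

/-- The homogenisation of a prime of the chart ring is a (homogeneous) prime of `k[x]`.
[cite: Hartshorne1977, I §2, proof of Prop. 2.2 and Ex. 2.10] -/
theorem isPrime_homogeneousCore_comap_dehomAway
    (𝔮 : Ideal (Away (grading k n) (X j : MvPolynomial (Fin (n + 1)) k))) [𝔮.IsPrime] :
    ((𝔮.comap (dehomAway k n j)).homogeneousCore (grading k n)).toIdeal.IsPrime :=
  (Ideal.comap_isPrime (dehomAway k n j) 𝔮).homogeneousCore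

/-- A proper homogeneous ideal of `k[x₀, …, xₙ]` lies in the ideal of the vertex (the kernel of
`constantCoeff`, i.e. `(x₀, …, xₙ)`): its forms of positive degree have no constant term, and it
contains no non-zero constant. [folklore] -/
private theorem le_ker_constantCoeff_of_isHomogeneous {J : Ideal (MvPolynomial (Fin (n + 1)) k)}
    (hJ : J.IsHomogeneous (grading k n)) (hJtop : J ≠ ⊤) :
    J ≤ RingHom.ker (constantCoeff : MvPolynomial (Fin (n + 1)) k →+* k) := by
  classical
  intro G hG
  rw [RingHom.mem_ker, ← DirectSum.sum_support_decompose (grading k n) G, map_sum]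
  refine Finset.sum_eq_zero fun i _ => ?_
  set φ : MvPolynomial (Fin (n + 1)) k :=
    (DirectSum.decompose (grading k n) G i : MvPolynomial (Fin (n + 1)) k) with hφ
  have hmem : φ ∈ J := hJ i hG
  have hhom : φ.IsHomogeneous i := (DirectSum.decompose (grading k n) G i).2
  rcases Nat.eq_zero_or_pos i with hi | hi
  · -- a constant in a proper ideal is zero
    subst hi
    have h0 : φ.totalDegree = 0 := Nat.eq_zero_of_le_zero hhom.totalDegree_le
    rw [totalDegree_eq_zero_iff_eq_C] at h0
    by_contra hc
    rw [constantCoeff_eq] at hc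
    apply hJtop
    rw [Ideal.eq_top_iff_one]
    rw [h0] at hmem
    have h1 : (1 : MvPolynomial (Fin (n + 1)) k) = C (coeff 0 φ)⁻¹ * C (coeff 0 φ) := by
      rw [← C_mul, inv_mul_cancel₀ hc, C_1]
    rw [h1]
    exact J.mul_mem_left _ hmem
  · rw [constantCoeff_eq]
    exact hhom.coeff_eq_zero (ne_of_eq_of_ne (map_zero _) hi.ne)

/-! ## Dehomogenisation of a homogeneous prime missing `x_j` -/

/-- For a homogeneous ideal `J` of `k[x]`, the dehomogenised ideal `ρ_j(J) B_j`, read in the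
localization `k[x]_{x_j} ⊇ B_j = (k[x]_{(x_j)})₀`, lies in the extension `J k[x]_{x_j}`: a form
`G ∈ J` of degree `m` gives `ρ_j(G) = G / x_j^m ∈ J k[x]_{x_j}`.
[cite: Hartshorne1977, I §2, proof of Prop. 2.2; II Prop. 2.5 (b)] -/
theorem map_dehomAway_le_comap_map {J : Ideal (MvPolynomial (Fin (n + 1)) k)}
    (hJ : J.IsHomogeneous (grading k n)) :
    J.map (dehomAway k n j) ≤
      (J.map (algebraMap (MvPolynomial (Fin (n + 1)) k)
        (Localization.Away (X j : MvPolynomial (Fin (n + 1)) k)))).comap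
        (algebraMap (Away (grading k n) (X j : MvPolynomial (Fin (n + 1)) k))
          (Localization.Away (X j : MvPolynomial (Fin (n + 1)) k))) := by
  classical
  rw [Ideal.map_le_iff_le_comap]
  intro G hG
  rw [Ideal.mem_comap, Ideal.mem_comap, ← DirectSum.sum_support_decompose (grading k n) G, map_sum,
    map_sum]
  refine Ideal.sum_mem _ fun i _ => ?_
  have hmem : (DirectSum.decompose (grading k n) G i : MvPolynomial (Fin (n + 1)) k) ∈ J := hJ i hG
  have hhom : (DirectSum.decompose (grading k n) G i : MvPolynomial (Fin (n + 1)) k) ∈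
      grading k n i := (DirectSum.decompose (grading k n) G i).2
  rw [HomogeneousLocalization.algebraMap_apply, val_dehomAway_of_mem j hhom,
    IsLocalization.mk'_mem_map_algebraMap_iff (Submonoid.powers (X j : MvPolynomial (Fin (n + 1)) k))]
  exact ⟨1, Submonoid.one_mem _, by rw [one_mul]; exact hmem⟩

variable {𝔭 : Ideal (MvPolynomial (Fin (n + 1)) k)} [𝔭.IsPrime]

/-- **A form lies in a homogeneous prime `𝔭 ∌ x_j` iff its dehomogenisation lies in `ρ_j(𝔭) B_j`**
(clear the denominator `x_j^m`, which is not in `𝔭`). [cite: Hartshorne1977, I §2, proof of Prop. 2.2 and Ex. 2.10] -/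
theorem mem_of_dehomAway_mem_map (h𝔭 : 𝔭.IsHomogeneous (grading k n))
    (hj : (X j : MvPolynomial (Fin (n + 1)) k) ∉ 𝔭)
    {m : ℕ} {G : MvPolynomial (Fin (n + 1)) k} (hG : G ∈ grading k n m)
    (h : dehomAway k n j G ∈ 𝔭.map (dehomAway k n j)) : G ∈ 𝔭 := by
  have h' := map_dehomAway_le_comap_map j h𝔭 h
  rw [Ideal.mem_comap, HomogeneousLocalization.algebraMap_apply, val_dehomAway_of_mem j hG,
    IsLocalization.mk'_mem_map_algebraMap_iff
      (Submonoid.powers (X j : MvPolynomial (Fin (n + 1)) k))] at h'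
  obtain ⟨s, ⟨e, rfl⟩, hs⟩ := h'
  exact (‹𝔭.IsPrime›.mem_or_mem hs).resolve_left fun h'' => hj (‹𝔭.IsPrime›.mem_of_pow_mem e h'')

/-- The dehomogenisation `ρ_j(𝔭) B_j` of a homogeneous prime `𝔭 ∌ x_j` is a proper ideal.
[cite: Hartshorne1977, I §2, proof of Prop. 2.2] -/
theorem map_dehomAway_ne_top (h𝔭 : 𝔭.IsHomogeneous (grading k n))
    (hj : (X j : MvPolynomial (Fin (n + 1)) k) ∉ 𝔭) : 𝔭.map (dehomAway k n j) ≠ ⊤ := by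
  intro h
  refine ‹𝔭.IsPrime›.ne_top ((Ideal.eq_top_iff_one _).mpr ?_)
  refine mem_of_dehomAway_mem_map j h𝔭 hj (SetLike.one_mem_graded (grading k n)) ?_
  rw [map_one, h]
  exact Submodule.mem_top

/-- **The dehomogenisation of a homogeneous prime `𝔭 ∌ x_j` is a prime of the chart ring**
(Hartshorne I Ex. 2.10 / proof of Prop. 2.2: `α` and `β` preserve primality).
[cite: Hartshorne1977, I §2, proof of Prop. 2.2 and Ex. 2.10] -/
theorem isPrime_map_dehomAway (h𝔭 : 𝔭.IsHomogeneous (grading k n))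
    (hj : (X j : MvPolynomial (Fin (n + 1)) k) ∉ 𝔭) : (𝔭.map (dehomAway k n j)).IsPrime := by
  rw [Ideal.isPrime_iff]
  refine ⟨map_dehomAway_ne_top j h𝔭 hj, fun {b b'} hbb' => ?_⟩
  obtain ⟨m, G, hG, rfl⟩ := exists_eq_dehomAway j b
  obtain ⟨m', G', hG', rfl⟩ := exists_eq_dehomAway j b'
  rw [← map_mul] at hbb'
  have hGG' : G * G' ∈ 𝔭 :=
    mem_of_dehomAway_mem_map j h𝔭 hj (SetLike.mul_mem_graded hG hG') hbb'
  exact (‹𝔭.IsPrime›.mem_or_mem hGG').imp (Ideal.mem_map_of_mem _) (Ideal.mem_map_of_mem _)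

/-- **Homogenising the dehomogenisation of a homogeneous prime `𝔭 ∌ x_j` gives `𝔭` back**
(Hartshorne: `β ∘ α = id` up to powers of `x_j`, which are not in `𝔭`).
[cite: Hartshorne1977, I §2, proof of Prop. 2.2 and Ex. 2.10] -/
theorem homogeneousCore_comap_map_dehomAway (h𝔭 : 𝔭.IsHomogeneous (grading k n))
    (hj : (X j : MvPolynomial (Fin (n + 1)) k) ∉ 𝔭) :
    (((𝔭.map (dehomAway k n j)).comap (dehomAway k n j)).homogeneousCore (grading k n)).toIdeal =
      𝔭 := by
  classical
  refine le_antisymm (fun G hG => ?_) ?_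
  · rw [← DirectSum.sum_support_decompose (grading k n) G]
    refine Ideal.sum_mem _ fun i _ => ?_
    have hi : (DirectSum.decompose (grading k n) G i : MvPolynomial (Fin (n + 1)) k) ∈
        (((𝔭.map (dehomAway k n j)).comap (dehomAway k n j)).homogeneousCore
          (grading k n)).toIdeal :=
      (Ideal.homogeneousCore (grading k n) _).isHomogeneous i hG
    exact mem_of_dehomAway_mem_map j h𝔭 hj (DirectSum.decompose (grading k n) G i).2
      ((mem_homogeneousCore_comap_dehomAway_iff j _ (DirectSum.decompose (grading k n) G i).2).mp hi)
  · calc 𝔭 = (𝔭.homogeneousCore (grading k n)).toIdeal :=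
          (h𝔭.toIdeal_homogeneousCore_eq_self).symm
      _ ≤ _ := Ideal.homogeneousCore_mono (grading k n) Ideal.le_comap_map

/-! ## Heights go down under dehomogenisation -/

omit [𝔭.IsPrime] in
/-- **The height of a chart prime is at most the height of its homogenisation**: homogenisation
`𝔮 ↦ (ρ_j⁻¹ 𝔮)^{hom}` is strictly monotone from `Spec B_j` to `Spec k[x]`, so chains of primes
below `𝔮` give chains below `(ρ_j⁻¹ 𝔮)^{hom}`. [cite: Hartshorne1977, I §2, proof of Prop. 2.2; I Ex. 2.6] -/
theorem height_le_height_homogeneousCore_comap_dehomAway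
    (𝔮 : Ideal (Away (grading k n) (X j : MvPolynomial (Fin (n + 1)) k))) [𝔮.IsPrime] :
    𝔮.height ≤ ((𝔮.comap (dehomAway k n j)).homogeneousCore (grading k n)).toIdeal.height := by
  let f : PrimeSpectrum (Away (grading k n) (X j : MvPolynomial (Fin (n + 1)) k)) →
      PrimeSpectrum (MvPolynomial (Fin (n + 1)) k) := fun Q =>
    ⟨((Q.asIdeal.comap (dehomAway k n j)).homogeneousCore (grading k n)).toIdeal,
      isPrime_homogeneousCore_comap_dehomAway j Q.asIdeal⟩
  have hf : StrictMono f := by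
    intro Q Q' hQQ'
    rw [← PrimeSpectrum.asIdeal_lt_asIdeal] at hQQ' ⊢
    exact lt_of_le_not_ge ((homogeneousCore_comap_dehomAway_le_iff j _ _).mpr hQQ'.le)
      fun h => hQQ'.not_ge ((homogeneousCore_comap_dehomAway_le_iff j _ _).mp h)
  have h := Order.height_le_height_apply_of_strictMono f hf ⟨𝔮, ‹_›⟩
  rwa [← PrimeSpectrum.height_eq_orderHeight, ← PrimeSpectrum.height_eq_orderHeight] at h

/-- **`ht ρ_j(𝔭) B_j ≤ ht 𝔭`** for a homogeneous prime `𝔭 ∌ x_j`.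
[cite: Hartshorne1977, I §2, proof of Prop. 2.2; I Ex. 2.6] -/
theorem height_map_dehomAway_le (h𝔭 : 𝔭.IsHomogeneous (grading k n))
    (hj : (X j : MvPolynomial (Fin (n + 1)) k) ∉ 𝔭) :
    (𝔭.map (dehomAway k n j)).height ≤ 𝔭.height := by
  haveI := isPrime_map_dehomAway j h𝔭 hj
  have h := height_le_height_homogeneousCore_comap_dehomAway j (𝔭.map (dehomAway k n j))
  rwa [homogeneousCore_comap_map_dehomAway j h𝔭 hj] at h

/-- **The height bound in the dimension currency**: if the homogeneous prime `𝔭 ∌ x_j` has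
`dim k[x₀,…,xₙ]/𝔭 = e` (so `ht 𝔭 = n + 1 - e`, `k[x]` being a catenary affine domain of dimension
`n + 1`), then `ht ρ_j(𝔭) B_j ≤ n + 1 - e` — the prime of the chart `D₊(x_j) ≅ 𝔸ⁿ` under a point of
`V₊(𝔭) ⊆ ℙⁿ` of dimension `e - 1` has height at most the codimension `n - (e - 1)`.
[cite: Hartshorne1977, I §2, proof of Prop. 2.2; I Ex. 2.6 and Prop. 1.13] -/
theorem height_map_dehomAway_le_of_ringKrullDim_quotient (h𝔭 : 𝔭.IsHomogeneous (grading k n))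
    (hj : (X j : MvPolynomial (Fin (n + 1)) k) ∉ 𝔭) {e : ℕ}
    (he : ringKrullDim (MvPolynomial (Fin (n + 1)) k ⧸ 𝔭) = e) :
    (𝔭.map (dehomAway k n j)).height ≤ (n + 1 - e : ℕ) := by
  obtain ⟨h, hh⟩ := exists_height_eq k 𝔭
  have hsum := height_add_eq_of_ringKrullDim_quotient k (ringKrullDim_mvPolynomial_fin_eq k (n + 1))
    𝔭 he hh
  calc (𝔭.map (dehomAway k n j)).height ≤ 𝔭.height := height_map_dehomAway_le j h𝔭 hj
    _ = h := hh
    _ ≤ (n + 1 - e : ℕ) := by exact_mod_cast (by omega : h ≤ n + 1 - e)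

/-! ## Dimensions go down by one under dehomogenisation -/

omit [𝔭.IsPrime] in
/-- **`dim B_j/𝔠 + 1 ≤ dim k[x]/J`** for a homogeneous ideal `J` and any ideal `𝔠 ⊇ ρ_j(J) B_j` of
the chart ring: a chain of primes `𝔮_0 < ⋯ < 𝔮_r` above `𝔠` homogenises to the chain
`𝔮_0^{hom} < ⋯ < 𝔮_r^{hom}` of homogeneous primes above `J`, which extends by the vertex ideal
`(x_0, …, x_n) ∋ x_j ∉ 𝔮_r^{hom}`. (The affine chart of a projective algebraic set of dimension `e - 1`
with cone of dimension `e` has dimension at most `e - 1`.)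
[cite: Hartshorne1977, I §2, proof of Prop. 2.2, Ex. 2.6 and Ex. 2.10] -/
theorem ringKrullDim_quotient_add_one_le_of_map_dehomAway_le
    {J : Ideal (MvPolynomial (Fin (n + 1)) k)} (hJ : J.IsHomogeneous (grading k n))
    {𝔠 : Ideal (Away (grading k n) (X j : MvPolynomial (Fin (n + 1)) k))}
    (h𝔠 : J.map (dehomAway k n j) ≤ 𝔠) :
    ringKrullDim (Away (grading k n) (X j : MvPolynomial (Fin (n + 1)) k) ⧸ 𝔠) + 1 ≤
      ringKrullDim (MvPolynomial (Fin (n + 1)) k ⧸ J) := by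
  classical
  by_cases htop : 𝔠 = ⊤
  · subst htop
    haveI : Subsingleton (Away (grading k n) (X j : MvPolynomial (Fin (n + 1)) k) ⧸
        (⊤ : Ideal (Away (grading k n) (X j : MvPolynomial (Fin (n + 1)) k)))) :=
      Ideal.Quotient.subsingleton_iff.mpr rfl
    rw [ringKrullDim_eq_bot_of_subsingleton]
    exact bot_le
  have hJtop : J ≠ ⊤ := fun h => htop (top_le_iff.mp (le_trans (by rw [h, Ideal.map_top]) h𝔠))
  haveI : Nonempty (PrimeSpectrum.zeroLocus (R := Away (grading k n)
      (X j : MvPolynomial (Fin (n + 1)) k)) (𝔠 : Set _)) := by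
    have hne : (PrimeSpectrum.zeroLocus (R := Away (grading k n)
        (X j : MvPolynomial (Fin (n + 1)) k)) (𝔠 : Set _)).Nonempty := by
      rw [Set.nonempty_iff_ne_empty, ne_eq, PrimeSpectrum.zeroLocus_empty_iff_eq_top]
      exact htop
    exact hne.to_subtype
  -- the vertex prime `𝔐 = (x_0, …, x_n)`
  set 𝔐 : Ideal (MvPolynomial (Fin (n + 1)) k) :=
    RingHom.ker (constantCoeff : MvPolynomial (Fin (n + 1)) k →+* k) with h𝔐def
  haveI h𝔐 : 𝔐.IsPrime := RingHom.ker_isPrime _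
  have hJ𝔐 : J ≤ 𝔐 := le_ker_constantCoeff_of_isHomogeneous hJ hJtop
  -- homogenisation of the primes above `𝔠`
  have hJQ : ∀ Q : PrimeSpectrum.zeroLocus (R := Away (grading k n)
      (X j : MvPolynomial (Fin (n + 1)) k)) (𝔠 : Set _),
      J ≤ ((Q.1.asIdeal.comap (dehomAway k n j)).homogeneousCore (grading k n)).toIdeal := by
    intro Q
    have hQ : 𝔠 ≤ Q.1.asIdeal := by
      have := Q.2
      rwa [PrimeSpectrum.mem_zeroLocus, SetLike.coe_subset_coe] at this
    calc J = (J.homogeneousCore (grading k n)).toIdeal := (hJ.toIdeal_homogeneousCore_eq_self).symm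
      _ ≤ _ := Ideal.homogeneousCore_mono (grading k n)
          (Ideal.le_comap_map.trans (Ideal.comap_mono (h𝔠.trans hQ)))
  have hQtop : ∀ Q : PrimeSpectrum.zeroLocus (R := Away (grading k n)
      (X j : MvPolynomial (Fin (n + 1)) k)) (𝔠 : Set _), Q.1.asIdeal ≠ ⊤ := fun Q =>
    Q.1.2.ne_top
  have hQ𝔐 : ∀ Q : PrimeSpectrum.zeroLocus (R := Away (grading k n)
      (X j : MvPolynomial (Fin (n + 1)) k)) (𝔠 : Set _),
      ((Q.1.asIdeal.comap (dehomAway k n j)).homogeneousCore (grading k n)).toIdeal < 𝔐 := by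
    intro Q
    refine lt_of_le_of_ne ?_ ?_
    · exact le_ker_constantCoeff_of_isHomogeneous (Ideal.homogeneousCore (grading k n) _).isHomogeneous
        (isPrime_homogeneousCore_comap_dehomAway j Q.1.asIdeal).ne_top
    · intro h
      apply X_not_mem_homogeneousCore_comap_dehomAway j (hQtop Q)
      rw [h, h𝔐def, RingHom.mem_ker, constantCoeff_X]
  let ψ : WithTop (PrimeSpectrum.zeroLocus (R := Away (grading k n)
      (X j : MvPolynomial (Fin (n + 1)) k)) (𝔠 : Set _)) →
      PrimeSpectrum.zeroLocus (R := MvPolynomial (Fin (n + 1)) k) (J : Set _) :=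
    fun x => WithTop.recTopCoe (C := fun _ =>
        PrimeSpectrum.zeroLocus (R := MvPolynomial (Fin (n + 1)) k) (J : Set _))
      ⟨⟨𝔐, h𝔐⟩, by rwa [PrimeSpectrum.mem_zeroLocus, SetLike.coe_subset_coe]⟩
      (fun Q => ⟨⟨((Q.1.asIdeal.comap (dehomAway k n j)).homogeneousCore (grading k n)).toIdeal,
          isPrime_homogeneousCore_comap_dehomAway j Q.1.asIdeal⟩,
        by rw [PrimeSpectrum.mem_zeroLocus, SetLike.coe_subset_coe]; exact hJQ Q⟩) x
  have hψ : StrictMono ψ := by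
    intro x y hxy
    induction x using WithTop.recTopCoe with
    | top => exact absurd hxy not_top_lt
    | coe Q =>
      induction y using WithTop.recTopCoe with
      | top =>
        change (⟨⟨_, _⟩, _⟩ : PrimeSpectrum.zeroLocus (R := MvPolynomial (Fin (n + 1)) k)
          (J : Set _)) < ⟨⟨𝔐, h𝔐⟩, _⟩
        rw [Subtype.mk_lt_mk, ← PrimeSpectrum.asIdeal_lt_asIdeal]
        exact hQ𝔐 Q
      | coe Q' =>
        have hQQ' : Q.1.asIdeal < Q'.1.asIdeal := by
          rw [PrimeSpectrum.asIdeal_lt_asIdeal]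
          exact Subtype.coe_lt_coe.mpr (WithTop.coe_lt_coe.mp hxy)
        change (⟨⟨_, _⟩, _⟩ : PrimeSpectrum.zeroLocus (R := MvPolynomial (Fin (n + 1)) k)
          (J : Set _)) < ⟨⟨_, _⟩, _⟩
        rw [Subtype.mk_lt_mk, ← PrimeSpectrum.asIdeal_lt_asIdeal]
        exact lt_of_le_not_ge ((homogeneousCore_comap_dehomAway_le_iff j _ _).mpr hQQ'.le)
          fun h => hQQ'.not_ge ((homogeneousCore_comap_dehomAway_le_iff j _ _).mp h)
  calc ringKrullDim (Away (grading k n) (X j : MvPolynomial (Fin (n + 1)) k) ⧸ 𝔠) + 1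
      = Order.krullDim (WithTop (PrimeSpectrum.zeroLocus (R := Away (grading k n)
          (X j : MvPolynomial (Fin (n + 1)) k)) (𝔠 : Set _))) := by
        rw [ringKrullDim_quotient, Order.krullDim_WithTop]
    _ ≤ Order.krullDim (PrimeSpectrum.zeroLocus (R := MvPolynomial (Fin (n + 1)) k) (J : Set _)) :=
        Order.krullDim_le_of_strictMono ψ hψ
    _ = ringKrullDim (MvPolynomial (Fin (n + 1)) k ⧸ J) := (ringKrullDim_quotient J).symm

omit [𝔭.IsPrime] in
/-- The numeric form consumed at a chart: if `dim k[x]/J ≤ l + 1` (cone of dimension `≤ l + 1`,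
projective dimension `≤ l`) then `dim B_j/𝔠 ≤ l` for every ideal `𝔠 ⊇ ρ_j(J) B_j` of the chart
ring. [cite: Hartshorne1977, I §2, proof of Prop. 2.2 and Ex. 2.6] -/
theorem ringKrullDim_quotient_le_of_map_dehomAway_le
    {J : Ideal (MvPolynomial (Fin (n + 1)) k)} (hJ : J.IsHomogeneous (grading k n))
    {𝔠 : Ideal (Away (grading k n) (X j : MvPolynomial (Fin (n + 1)) k))}
    (h𝔠 : J.map (dehomAway k n j) ≤ 𝔠) {l : ℕ}
    (hl : ringKrullDim (MvPolynomial (Fin (n + 1)) k ⧸ J) ≤ (l + 1 : ℕ)) :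
    ringKrullDim (Away (grading k n) (X j : MvPolynomial (Fin (n + 1)) k) ⧸ 𝔠) ≤ l := by
  have h := (ringKrullDim_quotient_add_one_le_of_map_dehomAway_le j hJ h𝔠).trans hl
  -- `x + 1 ≤ l + 1 ⇒ x ≤ l` in `WithBot ℕ∞`
  induction hx : ringKrullDim (Away (grading k n) (X j : MvPolynomial (Fin (n + 1)) k) ⧸ 𝔠)
    using WithBot.recBotCoe with
  | bot => exact bot_le
  | coe a =>
    rw [hx] at h
    induction a using ENat.recTopCoe with
    | top =>
      exfalso
      have h' : ((⊤ : ℕ∞) : WithBot ℕ∞) + 1 ≤ ((l + 1 : ℕ) : ℕ∞) := h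
      rw [← WithBot.coe_one, ← WithBot.coe_add, WithBot.coe_le_coe, top_add] at h'
      exact absurd h' (by simp)
    | coe a =>
      have h' : (((a + 1 : ℕ) : ℕ∞) : WithBot ℕ∞) ≤ ((l + 1 : ℕ) : ℕ∞) := by
        have : ((a : ℕ∞) : WithBot ℕ∞) + 1 = (((a + 1 : ℕ) : ℕ∞) : WithBot ℕ∞) := by
          push_cast; ring
        rw [← this]; exact h
      have : a + 1 ≤ l + 1 := by exact_mod_cast h'
      exact_mod_cast (by omega : a ≤ l)

omit [𝔭.IsPrime] in
/-- **A prime with positive-dimensional quotient misses a variable**: if `dim k[x₀,…,xₙ]/𝔭 ≠ 0`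
then `x_j ∉ 𝔭` for some `j` — otherwise `𝔭` contains the vertex ideal `(x₀, …, xₙ)`, which is
maximal, so `k[x]/𝔭` is a field. (A positive-dimensional point of the cone is a point of some
chart `D₊(x_j)`.) [cite: Hartshorne1977, I §2, proof of Prop. 2.2] -/
theorem exists_X_not_mem_of_ringKrullDim_quotient_ne_zero
    {𝔭 : Ideal (MvPolynomial (Fin (n + 1)) k)} [𝔭.IsPrime]
    (he : ringKrullDim (MvPolynomial (Fin (n + 1)) k ⧸ 𝔭) ≠ 0) :
    ∃ j : Fin (n + 1), (X j : MvPolynomial (Fin (n + 1)) k) ∉ 𝔭 := by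
  by_contra h
  push Not at h
  apply he
  have hsurj : Function.Surjective (constantCoeff : MvPolynomial (Fin (n + 1)) k →+* k) :=
    fun c => ⟨C c, constantCoeff_C _ c⟩
  have hmax : (RingHom.ker (constantCoeff : MvPolynomial (Fin (n + 1)) k →+* k)).IsMaximal :=
    RingHom.ker_isMaximal_of_surjective _ hsurj
  have hle : RingHom.ker (constantCoeff : MvPolynomial (Fin (n + 1)) k →+* k) ≤ 𝔭 := by
    intro G hG
    rw [RingHom.mem_ker, constantCoeff_eq] at hG
    have hspan : G ∈ Ideal.span (X '' (Set.univ : Set (Fin (n + 1))) :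
        Set (MvPolynomial (Fin (n + 1)) k)) := by
      rw [mem_ideal_span_X_image]
      intro m hm
      have hm0 : m ≠ 0 := by
        rintro rfl
        exact (mem_support_iff.mp hm) hG
      obtain ⟨i, hi⟩ := Finsupp.ne_iff.mp hm0
      exact ⟨i, Set.mem_univ i, by simpa using hi⟩
    exact Ideal.span_le.mpr (by rintro _ ⟨i, -, rfl⟩; exact h i) hspan
  have heq : 𝔭 = RingHom.ker (constantCoeff : MvPolynomial (Fin (n + 1)) k →+* k) :=
    (hmax.eq_of_le ‹𝔭.IsPrime›.ne_top hle).symm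
  haveI : 𝔭.IsMaximal := heq ▸ hmax
  exact ringKrullDim_eq_zero_of_isField (Ideal.Quotient.maximal_ideal_iff_isField_quotient 𝔭 |>.mp ‹_›)

end Literature.AlgebraicGeometry.Resolution

end
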